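import Summits.QuantumFields.BalabanUV.Beta.FP.HorizontalTailAssembly
import Summits.QuantumFields.BalabanUV.Beta.FP.HorizontalBookkeepingTailSum

/-!
# `BalabanUV.Beta.FP.HorizontalBookkeepingEnd` — road «FP» for binder row D1, row N7/H3-BOOK: THE END BY NAME — leaf-02's truncated transport (a)
# and tail transport (b-T) + leaf-05's decimation (b3′) and assembly (b4′) ⟹ the horizontal bookkeeping bound with ONLY the letters
# {(H1) at kernel level, the transport profile, the `t0Defect` size, `hgerm`} left as hypotheses

HONEST DEPENDENCY (page 1, mandatory): continuum YM on T⁴ ⇐ BetaPertH ∧ nine spine estimates (0/9 proved); BetaPertH ⇐ (D1) ∧ (D4) ∧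
CAP+tail; G-an2-4 gates asym, D1 and NE2/3/4.  HONEST FRAMING (cell contract, verbatim): «discharging `BetaPertH` makes Bałaban's UV
stability UNCONDITIONAL — a real constructive-QFT result; it is NOT the continuum limit and NOT the Clay problem.»  THIS MODULE is [folklore]
composition BY NAME of tree theorems (`FP/HorizontalBookkeeping` (a), leaf-02-g5; `FP/HorizontalBookkeepingTail*` (b-T), leaf-02-g6; `FP/DecimationTail`,
`FP/DecimationSecondMoment`, `FP/HorizontalTailAssembly` (b3′)/(b4′), leaf-05-g8); no `def`, no `Prop` fact, no cite, 0 `sorry`.  HYPOTHESES LEFT (each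
with its supplier): (H1) the horizontal identity at KERNEL level for the transported kernel (road FP row H1-KER = the shared composition lane;
model level `FP/HorizontalModel`), the transport letters (Kronecker masses, (L1∞) constants `Cw`, absolutely summable second moments, exponential
profile `(c/N⁵)·e^{−(δ/N)|x|₁}` — road FP rows IPROF-UNIF ∕ `TransportInfinityM`), the size of the truncated-transport defect `N⁶·|t0Defect| ≤ U₀`
(`HorizontalBookkeeping.pow_six_mul_abs_t0Defect_le` under the profile letters), the kernel letters (`|K| ≤ C(‖t‖∞+1)⁻⁶`, `|ΔK| ≤ C(‖t‖∞+1)⁻⁷`, evenness)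
and the log-asymptotics of the window function `hgerm` (road FP row H2-OBJ, owner).  FINDING F-d1leaf05g8-1: `hgerm` is necessary.
NOT hbook-discharged, NOT hasym, NOT D1, NOT BetaPertH, NOT continuum, NOT Clay.

ABSOLUTE RULE (cell charter, verbatim): «No internally-minted statement may enter as a cited fact. Every hypothesis is either kernel-proved in this
package or a verbatim quotation of a PUBLISHED theorem with page reference. The manuscript(s) under audit are NOT citable for their own disputed
steps — they are the thing under adjudication; programme-internal (2001/route/tribunal) claims are never citable.»

THE STATEMENT (`abs_secondMoment_sub_window_le_of_letters`): under the hypotheses above, for every block size `N ≥ 1` and channel `(μ, ν)`,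
`|secondMoment T μ ν − Σ_{0<‖z‖∞≤N} K μ ν z·z_μ·z_ν| ≤ U₀ + 161·A_T(C,c,δ) + (3·Cg + 67392·C) + |c₀|`, `A_T` = leaf-02-g6's displayed transport constant
(`HorizontalBookkeepingTailSum.abs_transport_tail_sub_le`), FREE OF `N`.  With `f m := secondMoment (T at N = Lc^m)` and `g` the window function this is the
`hbook` shape of `FP/HorizontalEnd.hasym_of_horizontal` (up to the ℕ/ℝ reading of the window argument).
Provenance: D1 formalisation swarm, unit b2b-balaban-beta-d1-formalise-leaf-05 gen 8 (prover-b2b-balaban-beta-d1-formalise-leaf-05-g8-0), 2026-08-20.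
-/

noncomputable section

namespace Summit.QuantumFields.BalabanUV.Beta.FP.HorizontalBookkeepingEnd

open Finset Filter Topology
open Literature.Probability.LatticeModels (box annulus)
open Literature.MathematicalPhysics.QuantumFieldTheory.Balaban1983to89
open Literature.MathematicalPhysics.QuantumFieldTheory.Balaban1983to89.Beta
open B12Sec2to5 (l1)
open DyadicShell (Pt supNorm)
open DecimatedMomentSummable (ConstReproSum LinReproSum AbsMoment₂ summable_of_absMoment₂)
open DressedMomentNormalisation (EKer dressedEntry)
open Summit.QuantumFields.BalabanUV.Beta.FP.HorizontalBookkeeping (truncK t0Defect)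
open Summit.QuantumFields.BalabanUV.Beta.FP.HorizontalBookkeepingTailSum (summable_weight_transport_tail_sub tail_apply_coarse
  dressedEntry_truncK_add_tail)
open Summit.QuantumFields.BalabanUV.Beta.FP.HorizontalTailAssembly (abs_secondMoment_sub_window_le hasSum_truncatedTransport)

/-- [folklore] **THE HORIZONTAL BOOKKEEPING BOUND FROM THE LETTERS, BY NAME.**  See the module docstring for the reading and the supplier of every
hypothesis; the conclusion is N-UNIFORM (the right member does not mention `N`). -/
theorem abs_secondMoment_sub_window_le_of_letters {K w : EKer 4} {C c δ : ℝ} {N : ℕ} (hN : 1 ≤ N) (hδ : 0 < δ) (hc : 0 ≤ c)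
    -- kernel letters
    (hK : ∀ c' e (t : Pt), |K c' e t| ≤ C / ((supNorm t : ℝ) + 1) ^ 6)
    (hdK : ∀ c' e (t : Pt) (i : Fin 4), |K c' e (t + Pi.single i 1) - K c' e t| ≤ C / ((supNorm t : ℝ) + 1) ^ 7)
    (heven : ∀ c' e (t : Pt), K c' e (-t) = K c' e t)
    -- transport letters
    (Cw : Fin 4 → Fin 4 → Fin 4 → ℝ)
    (hw0 : ∀ κ l, ConstReproSum N (w κ l) (if κ = l then (((N : ℝ) ^ (4 + 1))⁻¹) else 0))
    (hw1 : ∀ κ l, LinReproSum N (w κ l) (Cw κ l)) (hwA : ∀ κ l, AbsMoment₂ (w κ l))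
    (hw : ∀ κ l x, |w κ l x| ≤ c / (N : ℝ) ^ 5 * Real.exp (-(δ / N) * l1 x))
    -- (H1) at kernel level for the transported kernel, channel `(μ, ν)`
    {T D : EKer 4} (μ ν : Fin 4)
    (hH1 : ∀ v : Pt, (N : ℝ) ^ 8 * dressedEntry w K ((N : ℤ) • v) μ ν = T μ ν v + K μ ν v + D μ ν v)
    (hT : Summable fun v : Pt => T μ ν v * (v μ : ℝ) * (v ν : ℝ))
    (hD : HasSum (fun v : Pt => D μ ν v * (v μ : ℝ) * (v ν : ℝ)) 0)
    -- the size of the truncated-transport defect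
    {U₀ : ℝ} (hU0 : (N : ℝ) ^ 6 * |t0Defect N w (truncK K N) Cw μ ν μ ν| ≤ U₀)
    -- the log-asymptotics letter of the window function
    {s c₀ Cg : ℝ}
    (hgerm : ∀ M : ℕ, 1 ≤ M → |∑ z ∈ annulus 4 0 M, K μ ν z * (z μ : ℝ) * (z ν : ℝ) - (s * Real.log M + c₀)| ≤ Cg) :
    let AT : ℝ := (4 : ℝ) ^ 7 * (16 * C * c ^ 2 * (Real.exp (δ / 2) * (1 + 4 / δ) ^ 4) ^ 2 + C)
          + (5 / 4 : ℝ) ^ 7 * (C * c ^ 2 * Real.exp (δ / 2) ^ 2 * (1 + 4 / δ) ^ 8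
              * (128 * (4 / 3 : ℝ) ^ 7 * (2 / δ) + 4096 * 16 ^ 7 * 5040 * (2 / δ) ^ 7))
    |B12Beta.secondMoment T μ ν - ∑ z ∈ annulus 4 0 N, K μ ν z * (z μ : ℝ) * (z ν : ℝ)|
      ≤ U₀ + 161 * AT + (3 * Cg + 67392 * C) + |c₀| := by
  intro AT
  -- nonnegativity of the kernel constant
  have hC : 0 ≤ C := by
    have h := hK μ ν 0
    have h0 : (supNorm (0 : Pt) : ℝ) = 0 := by rw [DyadicShell.supNorm_eq_zero_iff.mpr rfl]; simp
    rw [h0, zero_add, one_pow, div_one] at h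
    exact (abs_nonneg _).trans h
  -- the three transported summands
  set X : Pt → ℝ := fun v => (N : ℝ) ^ 8 * dressedEntry w K ((N : ℤ) • v) μ ν with hX
  set Xtr : Pt → ℝ := fun v => (N : ℝ) ^ 8 * dressedEntry w (truncK K N) ((N : ℤ) • v) μ ν with hXtr
  set Xtl : Pt → ℝ := fun v => (N : ℝ) ^ 8 * dressedEntry w (K - truncK K N) ((N : ℤ) • v) μ ν with hXtl
  -- (T3) the split
  have hwS : ∀ κ l, Summable fun x => |w κ l x| := fun κ l => (summable_of_absMoment₂ (hwA κ l)).abs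
  have hsplit : ∀ v, X v = Xtr v + Xtl v := by
    intro v
    simp only [hX, hXtr, hXtl]
    rw [← dressedEntry_truncK_add_tail (N := N) hK hwS ((N : ℤ) • v) μ ν]
    ring
  -- (a) by name
  have ha := hasSum_truncatedTransport hN w K Cw hw0 hw1 hwA heven μ ν
  have hE₀ : |(N : ℝ) ^ 6 * t0Defect N w (truncK K N) Cw μ ν μ ν| ≤ U₀ := by
    rw [abs_mul, abs_of_nonneg (by positivity)]; exact hU0
  -- (b-T) by name
  obtain ⟨-, hsum, htsum, -⟩ := summable_weight_transport_tail_sub hN hδ hc hK hdK hw0 hw μ ν μ ν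
  have hb : HasSum (fun v : Pt =>
      (Xtl v - (if 1 < supNorm v then (N : ℝ) ^ 6 * K μ ν ((N : ℤ) • v) else 0)) * (v μ : ℝ) * (v ν : ℝ))
      (∑' v : Pt, ((v μ * v ν : ℤ) : ℝ) * ((N : ℝ) ^ 8 * dressedEntry w (K - truncK K N) ((N : ℤ) • v) μ ν
        - (N : ℝ) ^ 6 * (K - truncK K N) μ ν ((N : ℤ) • v))) := by
    refine hsum.hasSum.congr_fun fun v => ?_
    simp only [hXtl]
    rw [tail_apply_coarse hN K μ ν v]
    by_cases h1 : supNorm v ≤ 1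
    · rw [if_pos h1, if_neg (by omega)]; push_cast; ring
    · rw [if_neg h1, if_pos (by omega)]; push_cast; ring
  -- assemble
  have h := abs_secondMoment_sub_window_le (K := K) (T := T) (D := D) (μ := μ) (ν := ν) hN hsplit
    (by intro v; rw [← hH1 v]) hT hD ha hE₀ hb htsum hC (hK μ ν) (fun z i => hdK μ ν z i) hgerm
  exact h

end Summit.QuantumFields.BalabanUV.Beta.FP.HorizontalBookkeepingEnd

end
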